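import Mathlib
import Literature.NumberTheory.Transcendental.SemialgebraicRpow
import Literature.NumberTheory.Transcendental.KZIntervalPeriodProofs

/-!
# `TateLifting` (stmt-KontsevichZagierPeriods-9129), line `Sketch` — stub 42 `tateLifting_rootChart`

THE RADICAL CHART OF THE RATIONAL CURVE `yⁿ (c x + e) = a x + b`. Let
`K = ℚ̄ ∩ ℝ = algebraicClosure ℚ ℝ` be the field of real algebraic numbers, `a, b, c, e ∈ K` with
`a e − b c ≠ 0`, `0 < n`, and let `σ ⊆ ℝ¹` be a `ℚ`-semialgebraic set on which
`u(x) = (a x + b)/(c x + e) > 0`. The genus-zero sector of the line reduces the representation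
`[σ, R(x, y)]`, `y = ⁿ√u(x)`, to the Baker sector by ONE change of variables `t = y(x)`; this file
records the two elementary facts about the chart `t = u(x)^{1/n}` that the change of variables
needs:

* `x ↦ u(x)^{1/n}` is a `ℚ`-semialgebraic function on `σ` — `u` is semialgebraic (coordinate,
  real-algebraic constants, `+`, `*`, `/`; the denominator `c x + e` does not vanish on `σ` since
  otherwise `u(x) = 0` by Mathlib's `x / 0 = 0`), and rational powers of POSITIVE semialgebraic
  functions are semialgebraic (`IsSemialgebraicFunOn.rpow_ratCast`, Bochnak–Coste–Roy Prop. 2.2.6);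
* the inverse chart is RATIONAL: with `t = u(x)^{1/n}` one has `tⁿ = u(x)`,
  `a − c tⁿ = (a e − b c)/(c x + e) ≠ 0` and `x = (e tⁿ − b)/(a − c tⁿ)`.

References: M. Kontsevich, D. Zagier, *Periods* (2001), §1.2 rule (2) (change of variables);
J. Bochnak, M. Coste, M.-F. Roy, *Real Algebraic Geometry* (1998), Prop. 2.2.6.
-/

noncomputable section

open Set
open Literature.NumberTheory.Transcendental
open Literature.ModelTheory.ExponentialFields (IsSemialgebraic)

namespace Summit.KontsevichZagierPeriods.InverseLandau

namespace RootChart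

/-- On a set where the Möbius quotient `(a x + b)/(c x + e)` is positive the denominator does not
vanish (Mathlib: `y / 0 = 0`). [folklore] -/
theorem rc_denom_ne_zero {a b c e x : ℝ} (h : 0 < (a * x + b) / (c * x + e)) : c * x + e ≠ 0 := by
  intro h0
  rw [h0, div_zero] at h
  exact lt_irrefl 0 h

/-- The Möbius quotient `x ↦ (a x₀ + b)/(c x₀ + e)` with real-algebraic `a, b, c, e` is a
`ℚ`-semialgebraic function on every `ℚ`-semialgebraic `σ ⊆ ℝ¹` on which it is positive.
[cite: BochnakCosteRoy1998, Prop. 2.2.6] -/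
theorem rc_isSemialgebraicFunOn_moebius (a b c e : algebraicClosure ℚ ℝ) {σ : Set (Fin 1 → ℝ)}
    (hσ : IsSemialgebraic ℚ σ) (hpos : ∀ x ∈ σ, 0 < ((a : ℝ) * x 0 + b) / ((c : ℝ) * x 0 + e)) :
    IsSemialgebraicFunOn ℚ σ (fun x => ((a : ℝ) * x 0 + b) / ((c : ℝ) * x 0 + e)) := by
  have hX : IsSemialgebraicFunOn ℚ σ (fun x => x 0) := isSemialgebraicFunOn_apply hσ 0
  have hK : ∀ r : algebraicClosure ℚ ℝ, IsSemialgebraicFunOn ℚ σ (fun _ => (r : ℝ)) := fun r =>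
    isSemialgebraicFunOn_const_of_isAlgebraic hσ (mem_algebraicClosure_iff.1 r.2)
  have hAff : ∀ r s : algebraicClosure ℚ ℝ,
      IsSemialgebraicFunOn ℚ σ (fun x => (r : ℝ) * x 0 + s) := fun r s =>
    (IsSemialgebraicFunOn.add_holds (IsSemialgebraicFunOn.mul_holds (hK r) hX) (hK s)).congr
      fun x _ => rfl
  exact (hAff a b).div (hAff c e) fun x hx => rc_denom_ne_zero (hpos x hx)

/-- The `n`-th root `x ↦ ((a x₀ + b)/(c x₀ + e))^{1/n}` of a positive Möbius quotient with
real-algebraic coefficients is `ℚ`-semialgebraic (rational powers of positive semialgebraic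
functions). [cite: BochnakCosteRoy1998, Prop. 2.2.6] -/
theorem rc_isSemialgebraicFunOn_root (n : ℕ) (a b c e : algebraicClosure ℚ ℝ) {σ : Set (Fin 1 → ℝ)}
    (hσ : IsSemialgebraic ℚ σ) (hpos : ∀ x ∈ σ, 0 < ((a : ℝ) * x 0 + b) / ((c : ℝ) * x 0 + e)) :
    IsSemialgebraicFunOn ℚ σ
      (fun x => (((a : ℝ) * x 0 + b) / ((c : ℝ) * x 0 + e)) ^ ((n : ℝ)⁻¹)) := by
  refine ((rc_isSemialgebraicFunOn_moebius a b c e hσ hpos).rpow_ratCast hσ hpos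
    ((n : ℚ)⁻¹)).congr fun x _ => ?_
  simp only [Rat.cast_inv, Rat.cast_natCast]

/-- The inverse chart of `t = u^{1/n}`, `u = (a x + b)/(c x + e)`, `a e − b c ≠ 0`, `c x + e ≠ 0`:
`a − c u = (a e − b c)/(c x + e) ≠ 0` and `(e u − b)/(a − c u) = x`. [folklore] -/
theorem rc_inverse_chart {a b c e x : ℝ} (hdet : a * e - b * c ≠ 0) (hD : c * x + e ≠ 0) :
    a - c * ((a * x + b) / (c * x + e)) ≠ 0 ∧
      (e * ((a * x + b) / (c * x + e)) - b) / (a - c * ((a * x + b) / (c * x + e))) = x := by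
  have h1 : a - c * ((a * x + b) / (c * x + e)) = (a * e - b * c) / (c * x + e) := by
    field_simp
    ring
  have h2 : e * ((a * x + b) / (c * x + e)) - b = (a * e - b * c) * x / (c * x + e) := by
    rw [eq_div_iff hD, sub_mul, mul_div_assoc', div_mul_cancel₀ _ hD]
    ring
  have hne : a - c * ((a * x + b) / (c * x + e)) ≠ 0 := by
    rw [h1]
    exact div_ne_zero hdet hD
  refine ⟨hne, ?_⟩
  rw [div_eq_iff hne, h1, h2]
  field_simp

end RootChart

open RootChart in
/-- **The radical chart of the rational curve `yⁿ(cx + e) = ax + b`** (stub 42 `tateLifting_rootChart`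
of the lead's skeleton, `K = ℚ̄ ∩ ℝ`): for real-algebraic `a, b, c, e` with `a e − b c ≠ 0`, `0 < n`,
and a `ℚ`-semialgebraic `σ ⊆ ℝ¹` on which `u(x) = (a x + b)/(c x + e) > 0`, the radical
`t(x) = u(x)^{1/n}` is a `ℚ`-semialgebraic function on `σ`, and it is inverted by the RATIONAL chart
`x = (e tⁿ − b)/(a − c tⁿ)` (whose denominator does not vanish). This is the change of variables
`t = y` of rule (2) that sends `[σ, R(x, ⁿ√u(x))]` to the Baker sector.
[cite: KontsevichZagier2001, §1.2 rule (2)] -/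
theorem tateLifting_rootChart :
    ∀ (n : ℕ) (a b c e : algebraicClosure ℚ ℝ) (σ : Set (Fin 1 → ℝ)), IsSemialgebraic ℚ σ → 0 < n →
      (a : ℝ) * e - b * c ≠ 0 →
      (∀ x ∈ σ, 0 < ((a : ℝ) * x 0 + b) / ((c : ℝ) * x 0 + e)) →
      IsSemialgebraicFunOn ℚ σ (fun x => (((a : ℝ) * x 0 + b) / ((c : ℝ) * x 0 + e)) ^ ((n : ℝ)⁻¹)) ∧
        ∀ x ∈ σ,
          (a : ℝ) - c * ((((a : ℝ) * x 0 + b) / ((c : ℝ) * x 0 + e)) ^ ((n : ℝ)⁻¹)) ^ n ≠ 0 ∧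
          ((e : ℝ) * ((((a : ℝ) * x 0 + b) / ((c : ℝ) * x 0 + e)) ^ ((n : ℝ)⁻¹)) ^ n - b) /
              ((a : ℝ) - c * ((((a : ℝ) * x 0 + b) / ((c : ℝ) * x 0 + e)) ^ ((n : ℝ)⁻¹)) ^ n) = x 0 := by
  intro n a b c e σ hσ hn hdet hpos
  refine ⟨rc_isSemialgebraicFunOn_root n a b c e hσ hpos, fun x hx => ?_⟩
  rw [Real.rpow_inv_natCast_pow (hpos x hx).le hn.ne']
  exact rc_inverse_chart hdet (rc_denom_ne_zero (hpos x hx))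

end Summit.KontsevichZagierPeriods.InverseLandau
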